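import Summits.NavierStokesRegularity.FunctionalMining.MiddleEigenvalueMomentDoorReal
import HarnessLib

/-!
# FunctionalMining/NoGo — Conjecture F (rigidity of `λ₂(S) ≤ 0` on `T³`) and its witness form

Search for candidate a priori estimates; no regularity claim. No-go seat (pub-nsfunc-nogo, gen 5),
staged for the prove seat.

`middleEigenvalueMomentRateFails_of_nonpos_middle` (dict, `MiddleEigenvalueMomentDoor`) refutes
`MiddleEigenvalueMomentRateBound (2m) C` for EVERY `C` from one smooth divergence-free field on `T³`
with `λ₂(S) ≤ 0` everywhere and `∫|ω|^{2(m−1)}σ > 0`. CONJECTURE F (cell dictionary Q2″, NOGO T17)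
asked whether the hypothesis class is trivial: `λ₂(S) ≤ 0` everywhere ⇒ `λ₂(S) ≡ 0`.

STATUS (2026-08-20): REFUTED at paper level, NON-CONSTRUCTIVELY and UNREFEREED — NOGO.md
N11(h)(F8)(vii) / `pub-nsfunc-nogo/CONJECTURE_F.md` (THEOREM F̄: a divergence-free trigonometric
polynomial with `λ₂(S) < 0`, i.e. `det S > 0`, at every point of `T³` exists; Hahn–Banach duality for
the first-order problem around a degenerate 'pattern base' plus a complete classification of the dual
certificates). NOTHING of that argument is formalised here. This file only RECORDS the two statements
in the kernel vocabulary of the door and proves the two elementary links: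
`StrictlyNegativeMiddleFieldExists → ¬ MiddleEigenvalueRigidity` and
'strict witness with positive weighted stretching ⇒ kill-all'. An explicit witness, once certified
(census, exact lane), would be stated as `StrictlyNegativeMiddleFieldExists hd`.
-/

noncomputable section

open MeasureTheory

namespace Summit.NavierStokesRegularity.FunctionalMining

open Literature.Analysis Literature.Analysis.FunctionSpaces Literature.Analysis.FunctionSpaces.Torus
  Literature.Analysis.FluidPDE

variable {d : Type*} [Fintype d] [DecidableEq d]

/-- **Conjecture F (middle-eigenvalue rigidity on `T³`; dict Q2″, NOGO T17).** Every smooth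
divergence-free field on `T³` whose middle strain eigenvalue (Mathlib's decreasing `eigenvalues₀`,
index `1` of `3`, as in `MiddleEigenvalueMomentRateBound`) is `≤ 0` at every point has it `= 0` at
every point. REFUTED at paper level (non-constructive, unrefereed): NOGO N11(h)(F8)(vii),
CONJECTURE_F.md. Recorded, not decided, in Lean. Search for candidate a priori estimates; no
regularity claim. [ours] -/
@[conjecture] def MiddleEigenvalueRigidity : Prop :=
  ∀ hd : Fintype.card d = 3, ∀ v : UnitAddTorus d → EuclideanSpace ℝ d,
    Torus.IsSmooth v → Torus.IsDivFree v →
      (∀ x, ∀ hx : (Matrix.of fun i j =>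
          (Torus.partialDeriv j v x i + Torus.partialDeriv i v x j) / 2).IsHermitian,
          hx.eigenvalues₀ (Fin.cast hd.symm 1) ≤ 0) →
      ∀ x, ∀ hx : (Matrix.of fun i j =>
          (Torus.partialDeriv j v x i + Torus.partialDeriv i v x j) / 2).IsHermitian,
          hx.eigenvalues₀ (Fin.cast hd.symm 1) = 0

/-- **THEOREM F̄ as a statement (witness form of ¬ Conjecture F).** Some smooth divergence-free field
on `T³` has middle strain eigenvalue `< 0` (equivalently `det S > 0`: two compressive principal
strains) at EVERY point. Asserted at paper level by NOGO N11(h)(F8)(vii) (non-constructive,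
unrefereed); NOT proved in Lean; an explicit certified witness would prove it here. Search for
candidate a priori estimates; no regularity claim. [ours] -/
@[conjecture] def StrictlyNegativeMiddleFieldExists (hd : Fintype.card d = 3) : Prop :=
  ∃ v : UnitAddTorus d → EuclideanSpace ℝ d, Torus.IsSmooth v ∧ Torus.IsDivFree v ∧
    ∀ x, ∀ hx : (Matrix.of fun i j =>
        (Torus.partialDeriv j v x i + Torus.partialDeriv i v x j) / 2).IsHermitian,
        hx.eigenvalues₀ (Fin.cast hd.symm 1) < 0

/-- A strictly negative-middle field refutes Conjecture F (evaluate the rigidity conclusion at the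
point `0`). [ours; elementary] -/
theorem not_middleEigenvalueRigidity_of_strictlyNegative (hd : Fintype.card d = 3)
    (h : StrictlyNegativeMiddleFieldExists (d := d) hd) : ¬ MiddleEigenvalueRigidity (d := d) := by
  intro hR
  obtain ⟨v, hv, hdiv, hneg⟩ := h
  have hx0 : (Matrix.of fun i j =>
      (Torus.partialDeriv j v 0 i + Torus.partialDeriv i v 0 j) / 2).IsHermitian :=
    Matrix.isHermitian_iff_isSymm.mpr (strainMatrix_isSymm v 0)
  have h0 : hx0.eigenvalues₀ (Fin.cast hd.symm 1) = 0 :=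
    hR hd v hv hdiv (fun x hx => (hneg x hx).le) 0 hx0
  exact (hneg 0 hx0).ne h0

/-- **Witness ⇒ kill-all.** A smooth divergence-free field on `T³` with `λ₂(S) < 0` everywhere and
positive weighted stretching `2m∫|ω|^{2(m−1)}σ > 0` refutes `MiddleEigenvalueMomentRateBound (2m) C`
for every `C` — the door theorem `middleEigenvalueMomentRateFails_of_nonpos_middle` with the strict
pointwise hypothesis. THEOREM F̄ supplies fields satisfying the first hypothesis (paper level); whether
one of them satisfies the second for some `m ≥ 2` is OPEN (`m = 1` is impossible by Betchov). Search
for candidate a priori estimates; no regularity claim. [ours; elementary] -/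
theorem middleEigenvalueMomentRateFails_of_strictlyNegative_middle {m : ℕ}
    (hd : Fintype.card d = 3) {v : UnitAddTorus d → EuclideanSpace ℝ d} (hv : Torus.IsSmooth v)
    (hdiv : Torus.IsDivFree v)
    (hneg : ∀ x, ∀ hx : (Matrix.of fun i j =>
        (Torus.partialDeriv j v x i + Torus.partialDeriv i v x j) / 2).IsHermitian,
        hx.eigenvalues₀ (Fin.cast hd.symm 1) < 0)
    (hpos : 0 < 2 * m * ∫ x, torusVorticitySqAt v x ^ (m - 1) * torusStretchingDensity v x) :
    ∀ C : ℝ, ¬ MiddleEigenvalueMomentRateBound (d := d) (2 * m) C :=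
  middleEigenvalueMomentRateFails_of_nonpos_middle hd hv hdiv (fun x hx => (hneg x hx).le) hpos

end Summit.NavierStokesRegularity.FunctionalMining

end
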